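import Mathlib
import Summits.Ventures.PercRepro.TriangleCapFourRowTwo
import Summits.Ventures.PercRepro.TriangleCapThreeBelowSecondBest

/-!
# PercRepro — THE SECOND-BEST LOCUS TWO BELOW THE DIAGONAL ON EVERY ROW, AND THE TABLE WITH `r ≤ 3` IN THE
CHERRY COORDINATES (p3, gen 45; part 202)

At `r = 2` the second-best value is `closed − 2` on every row (part 197), attained by the bipartite `2`-matchings;
the non-`a`-bipartite graphs are further below — `B2 ≥ 6` for `a ≥ 5` (part 197, `two_below_second_best_locus`),
`T = 2 (k − 7) ≥ 4` on the row `a = 3` (part 190, `k ≥ 9`), `T = 2k − 18 ≥ 4` on the row `a = 4` (part 198,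
`k ≥ 11`) — so THE SECOND-BEST GRAPHS TWO BELOW THE DIAGONAL ARE EXACTLY THE `a`-BIPARTITE GRAPHS WHOSE TWO MISSING
PAIRS ARE NOT A STAR, on every row (`two_below_second_best_locus_all`). `cherry_table_second_best_three_below`: the
table of part 199 (`second_best_table''`, every cell with `r ≤ 3`) in the coordinates of the cherry table,
`2 · Σ_v C(d(v), 2)`. Axioms: standard.
-/

namespace PercRepro

namespace TriangleCap

namespace C047

open Finset

variable {V : Type*} [Fintype V] [DecidableEq V]

/-- **THE SECOND-BEST LOCUS ON THE CELL `(k, 3, 2)`, `k ≥ 9`:** a `K₄⁻`-free graph with `3 (k − 3) − 2` edges at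
`Σ_v d(v)² + 2 (k − 3) + 2 = m k` is `3`-bipartite with two missing pairs that are not a star. -/
theorem two_below_second_best_locus_three (D : SimpleGraph V) [DecidableRel D.Adj] (hK : K4mFree D)
    (hk : 9 ≤ Fintype.card V) (hm : D.edgeFinset.card + 2 = 3 * (Fintype.card V - 3))
    (heq : ∑ v, deg D v * deg D v + 2 * (Fintype.card V - 3) + 2 = D.edgeFinset.card * Fintype.card V) :
    ∃ A : Finset V, A.card = 3 ∧ BipSub D A ∧ ¬ ∃ v, MissingStar D A v := by
  by_cases hnb : ∃ A : Finset V, A.card = 3 ∧ BipSub D A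
  · obtain ⟨A, hAcard, hA⟩ := hnb
    refine ⟨A, hAcard, hA, ?_⟩
    rintro ⟨v, hv⟩
    have h := closed_form_eq_of_missingStar D A hA hv 3 2 hAcard hm (by omega)
    have e : Fintype.card V - 1 - 2 = Fintype.card V - 3 := by omega
    rw [e] at h
    omega
  · exfalso
    have h := three_row_second_order_pos D hK 2 (by norm_num) (by omega) (by omega) hnb
    have e : Fintype.card V - 1 - 2 = Fintype.card V - 3 := by omega
    rw [e] at h
    omega

/-- **THE SECOND-BEST LOCUS ON THE CELL `(k, 4, 2)`, `k ≥ 11`:** a `K₄⁻`-free graph with `4 (k − 4) − 2` edges at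
`Σ_v d(v)² + 2 (k − 3) + 2 = m k` is `4`-bipartite with two missing pairs that are not a star. -/
theorem two_below_second_best_locus_four (D : SimpleGraph V) [DecidableRel D.Adj] (hK : K4mFree D)
    (hk : 11 ≤ Fintype.card V) (hm : D.edgeFinset.card + 2 = 4 * (Fintype.card V - 4))
    (heq : ∑ v, deg D v * deg D v + 2 * (Fintype.card V - 3) + 2 = D.edgeFinset.card * Fintype.card V) :
    ∃ A : Finset V, A.card = 4 ∧ BipSub D A ∧ ¬ ∃ v, MissingStar D A v := by
  rcases four_two_second_order D hK (by omega) hm with ⟨A, hAcard, hA⟩ | h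
  · refine ⟨A, hAcard, hA, ?_⟩
    rintro ⟨v, hv⟩
    have h := closed_form_eq_of_missingStar D A hA hv 4 2 hAcard hm (by omega)
    have e : Fintype.card V - 1 - 2 = Fintype.card V - 3 := by omega
    rw [e] at h
    omega
  · exfalso
    omega

/-- **THE SECOND-BEST LOCUS TWO BELOW THE DIAGONAL ON EVERY ROW:** `3 ≤ a`, `2a + 2 ≤ k` (`k ≥ 9` at `a = 3`, `k ≥ 11`
at `a = 4`): a `K₄⁻`-free graph with `a (k − a) − 2` edges at `Σ_v d(v)² + 2 (k − 3) + 2 = m k` is `a`-bipartite with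
two missing pairs that are not a star — a `2`-matching removed from `K_{a,k−a}`. -/
theorem two_below_second_best_locus_all (D : SimpleGraph V) [DecidableRel D.Adj] (hK : K4mFree D) (a : ℕ)
    (ha : 3 ≤ a) (hk : 2 * a + 2 ≤ Fintype.card V) (hk3 : a = 3 → 9 ≤ Fintype.card V)
    (hk4 : a = 4 → 11 ≤ Fintype.card V) (hm : D.edgeFinset.card + 2 = a * (Fintype.card V - a))
    (heq : ∑ v, deg D v * deg D v + 2 * (Fintype.card V - 3) + 2 = D.edgeFinset.card * Fintype.card V) :
    ∃ A : Finset V, A.card = a ∧ BipSub D A ∧ ¬ ∃ v, MissingStar D A v := by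
  rcases Nat.lt_or_ge a 5 with ha5 | ha5
  · rcases Nat.lt_or_ge a 4 with ha4 | ha4
    · have ha3 : a = 3 := by omega
      subst ha3
      exact two_below_second_best_locus_three D hK (hk3 rfl) hm heq
    · have ha4' : a = 4 := by omega
      subst ha4'
      exact two_below_second_best_locus_four D hK (hk4 rfl) hm heq
  · exact two_below_second_best_locus D hK a ha5 hk hm heq

/-- **THE SECOND-BEST VALUE OF THE CHERRY TABLE ON EVERY CELL WITH `r ≤ 3`, IN THE TABLE'S COORDINATES:** every
non-extremal `K₄⁻`-free graph on `Fin k` with `a (k − a) − r` edges has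
`2 · cherries D + r (k − 1 − r) + secondGap k a r ≤ m (k − 2)`, and the value is attained. -/
theorem cherry_table_second_best_three_below (k a r : ℕ) (ha : 3 ≤ a) (hr : r ≤ 3) (hk : 2 * a + 2 ≤ k)
    (hk3 : a = 3 → r + 7 ≤ k) (hkr : r = 3 → 2 * a + 3 ≤ k) :
    (∀ (D : SimpleGraph (Fin k)) [DecidableRel D.Adj], K4mFree D → D.edgeFinset.card + r = a * (k - a) →
        2 * cherries D + r * (k - 1 - r) ≠ D.edgeFinset.card * (k - 2) →
        2 * cherries D + r * (k - 1 - r) + secondGap k a r ≤ D.edgeFinset.card * (k - 2)) ∧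
      ∃ (D : SimpleGraph (Fin k)) (_ : DecidableRel D.Adj), K4mFree D ∧ D.edgeFinset.card + r = a * (k - a) ∧
        2 * cherries D + r * (k - 1 - r) + secondGap k a r = D.edgeFinset.card * (k - 2) := by
  have hcard : Fintype.card (Fin k) = k := Fintype.card_fin k
  obtain ⟨h1, D, inst, hK, hE, hS⟩ := second_best_table'' k a r ha hr hk hk3 hkr
  refine ⟨?_, D, inst, hK, hE, ?_⟩
  · intro D _ hK hm hne
    have hne' : ∑ v, deg D v * deg D v + r * (k - 1 - r) ≠ D.edgeFinset.card * k := by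
      intro h
      apply hne
      have := (sum_deg_sq_eq_iff_cherries D (r * (k - 1 - r)) (by rw [hcard]; omega)).mp (by rw [hcard]; exact h)
      rw [hcard] at this
      exact this
    have h := h1 D hK hm hne'
    have := (sum_deg_sq_le_iff_cherries D (r * (k - 1 - r) + secondGap k a r) (by rw [hcard]; omega)).mp
      (by rw [hcard, ← add_assoc]; exact h)
    rw [hcard] at this
    rw [add_assoc]
    exact this
  · have := (sum_deg_sq_eq_iff_cherries D (r * (k - 1 - r) + secondGap k a r) (by rw [hcard]; omega)).mp
      (by rw [hcard, ← add_assoc]; exact hS)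
    rw [hcard] at this
    rw [add_assoc]
    exact this

end C047

end TriangleCap

end PercRepro
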